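import Summits.AtomisticToContinuum.Crystallization.Theses.PalmUnimodularRigidity
import Summits.AtomisticToContinuum.Crystallization.Theorems.ShellsToBarlowChart.Negative.Calibration
import Summits.AtomisticToContinuum.Crystallization.Theorems.ShellsToBarlowChart.Negative.ScaleWindow
import Literature.Geometry.DiscreteGeometry.LayerStackings
import Literature.Geometry.DiscreteGeometry.DelaunaySubdivision

/-!
# Line `flat-radial-development` — skeleton for crux `ShellsToBarlowChart`
(stmt-AtomisticToContinuum-9227, route `PalmUnimodularRigidity`, rank-4 crux)

Crux (verbatim, `Theses/PalmUnimodularRigidity.lean`): a non-empty `S ⊆ ℝ³` in which EVERY point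
`x` has, at its own scale `aₓ ∈ [9/10, 1]`, its whole `5aₓ/4`-shell `(1/100)·aₓ`-matched (after a
linear isometry) to the `aₓ`-scaled FCC or HCP kissing pattern, is bond-isomorphic to an ideal
Barlow stacking: `∃ s` Hägg, `∃ Φ : barlowStacking 1 √(2/3) s → S` bijective with
`dist p q = 1 ↔ 0 < dist (Φ p) (Φ q) ≤ 28/25`.

Idea (card `Ideas/flat-radial-development.md`, triage r1-1/2/3: pass ×3, merge ≈
`straightening-development`): forget the perturbed positions once the combinatorics is read off —
the canonical DELAUNAY CELLS of the Delone set `S` are bond tetrahedra and (parts of) bond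
octahedra (`stub_trussCells`, the only place the `1 %` is spent, together with `stub_delone`);
declaring every cell regular of edge `1` puts a flat `(E³, Isom E³)`-structure on actual `ℝ³`
(dihedral sum `2·arccos(1/3) + 2·arccos(−1/3) = 2π` at every bond); DEVELOP it — radially from one
atom, or by the tree's development theorem — to get ONE map `D` that is exact on every closed star
(`stub_radialDevelopment`); LIFT model segments back / use the covering criterion to see that such a
star-exact development of a set WITHOUT BOUNDARY is injective, `1`-separated and has exact shells
(`stub_radialLifting`); then `2 • D '' S` is a unit-ball packing all of whose kissing shells are the
FCC/HCP patterns and `HalesDSP_layerPackings_holds` (tree, PROVED) returns the Hägg word and the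
chart (`stub_developedChart`, the card's Transfer `C⁺ → crux`).

## Shape (what `ledger skeleton check --crux stmt-AtomisticToContinuum-9227` audits)

* five registered stubs `stub_delone`, `stub_trussCells`, `stub_radialDevelopment`,
  `stub_radialLifting`, `stub_developedChart` — each `theorem stub_… : <statement> := by sorry`,
  each statement INLINED over tree declarations only (`ShellCloseTo`, `fccKissingPattern`,
  `hcpKissingPattern`, `IsDelaunayCell`, `barlowStacking`, `IsHaggSeq`, Mathlib), so that a
  prover's `--supports stmt-AtomisticToContinuum-9227` file never imports this work file: copy the
  two `open` lines and the `local notation "E3"` line below and the statement elaborates verbatim;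
* the kernel-checked composition `ShellsToBarlowChart_of : ShellsToBarlowChart` (no hypotheses;
  it `have`s the five stubs by name; the ONLY theorem of this file whose head is the crux decl);
* § 0 is documentation vocabulary (`GoodShells`, `IsBond`, `IsDelone`, `HasTrussCells`,
  `IsStarExactDev`, `IsExactDev`, `BarlowChart`) with `Iff.rfl` read-backs of the inlined blocks.

## Disproof used (`Cruxes/ShellsToBarlowChart/Disproof.lean`, cycle 2b; landed parts
`Theorems/ShellsToBarlowChart/Negative/{Calibration,ScaleWindow}.lean` imported above, `Negative/Tolerance.lean`
(landed 02:25Z, module not yet built on the farm at check time) cited by name)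

* `shellsToBarlowChart_false_without_nonempty` — `S.Nonempty` is a hypothesis of `stub_delone`
  (covering radius of `∅` is infinite) and of `stub_developedChart` (Hales's `V.Nonempty`), and is
  threaded through `stub_radialDevelopment` (base atom of the radial development).
* `shellsToBarlowChart_false_without_scaleUpper` / `…_scaleLower` — the window `[9/10, 1]` enters
  ONLY through "window graph = shell graph, links exact" (`margins` (1)–(4)): `stub_delone` (hard
  core `0.99·aₓ ≥ 0.891`), `stub_trussCells` (bonds of a cell are shell pairs), and the star
  identification inside `stub_radialDevelopment` / `stub_radialLifting` (bond set of `x` =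
  its twelve shell points, `card_eq_twelve_of_shellCloseTo`).
* `shellsToBarlowChart_false_subshell` — `↑T = shell` (not `⊆`) is used in `stub_delone` (a point
  within `5aₓ/4` IS a shell point, hence `≥ 0.99aₓ` away) and in `stub_trussCells` (no foreign site
  on or inside an empty sphere: the interpenetrating witness `B ∪ (B + t)` is exactly a Delaunay
  cell with a foreign vertex).
* `shellsToBarlowChart_false_tol_eighth` — tolerance enters only via the margins; we sit at `1/100`
  where the local combinatorics is that of the exact case (Disproof § Local rigidity, first new
  option at `η ≥ 0.0646`).
* `not_shellsToFccChart` — the word `s` is READ OFF by Hales's theorem inside `stub_developedChart`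
  (existential, whatever the stacking is); nothing fixes it.
* calibration `hypothesis_barlowStacking` — the hypothesis class is non-vacuous; every stub is
  consistent with ideal stackings at scale `c ∈ [9/10, 1]` (their Delaunay cells ARE the regular
  truss, the development is a similarity).
No stub is an instance of a landed Negative lemma (all keep the verbatim hypothesis: window
`[9/10,1]`, tolerance `a/100`, `↑T =` shell, existential word).

## Numbers (by hand + triage panels; toy `kit j011074` = `toy/truss_check.py` v2, summary on the item)

hard core `0.99·(9/10) = 0.891 ≥ 89/100`; covering radius `≤ 1.01/(2 cos 45.58°)·aₓ = 0.7215·aₓ ≤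
3/4` (pattern directions cover `S²` within `45°`, `+0.58°` of blur); bond window: shell pairs
`≤ 1.01 ≤ 28/25 < 1.125 ≤ 5aₓ/4`, pattern-adjacent `≤ 1.02`, non-adjacent `≥ 1.2548`; Delaunay
emptiness: tetrahedral hole circumradius `0.612a` vs nearest foreign site `1.02a` (hcp bipyramid
apex) / `1.17a`, octahedral hole `0.707a` vs `1.225a` — margins `≥ 0.41a` against `≤ 0.05a` of
two-shell distortion; empty annulus `(5a/4, 1.33a)` (sharpened from `27/20`, triage r1-1/2/3:
margin `×4`); flatness exact: `arccos(1/3) + arccos(−1/3) = π`; star of a vertex of a unit octet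
tiling contains `B(u, √(2/3))`, so non-co-cellular vertices are `≥ 1.633` apart.
-/

noncomputable section

namespace Summit.AtomisticToContinuum.Crystallization.Cruxes.ShellsToBarlowChart.FlatRadialDevelopment

open Literature.Geometry.DiscreteGeometry Literature.MathematicalPhysics.StatisticalMechanics
open Summit.AtomisticToContinuum.Crystallization.Theses.PalmUnimodularRigidity

/-- Euclidean `3`-space (provers: copy this line together with the two `open` lines above). -/
local notation "E3" => EuclideanSpace ℝ (Fin 3)

/-! ## § 0  Vocabulary — documentation only (the stubs INLINE these blocks verbatim) -/

/-- **The crux hypothesis** ("every point has a `1 %`-good shell at its own scale"), verbatim the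
antecedent of `ShellsToBarlowChart`. -/
def GoodShells (S : Set E3) : Prop :=
  ∀ x ∈ S, ∃ a : ℝ, 9 / 10 ≤ a ∧ a ≤ 1 ∧ ∃ T : Finset E3,
    (↑T : Set E3) = (fun y : E3 => y - x) '' {y : E3 | y ∈ S ∧ y ≠ x ∧ dist y x ≤ 5 / 4 * a} ∧
    (ShellCloseTo (a / 100) T (Finset.image (fun v : E3 => a • v) fccKissingPattern) ∨
      ShellCloseTo (a / 100) T (Finset.image (fun v : E3 => a • v) hcpKissingPattern))

/-- **The crux conclusion** for `S` (a global bond-isomorphism with an ideal Barlow stacking),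
verbatim the consequent of `ShellsToBarlowChart`. -/
def BarlowChart (S : Set E3) : Prop :=
  ∃ s : ℤ → ℤ, IsHaggSeq s ∧ ∃ Φ : E3 → E3,
    Set.BijOn Φ (barlowStacking 1 (Real.sqrt (2 / 3)) s) S ∧
    ∀ p ∈ barlowStacking 1 (Real.sqrt (2 / 3)) s, ∀ q ∈ barlowStacking 1 (Real.sqrt (2 / 3)) s,
      (dist p q = 1 ↔ (0 < dist (Φ p) (Φ q) ∧ dist (Φ p) (Φ q) ≤ 28 / 25))

/-- The crux IS `∀ S, S.Nonempty → GoodShells S → BarlowChart S` (definitional read-back). -/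
theorem shellsToBarlowChart_iff :
    ShellsToBarlowChart ↔ ∀ S : Set E3, S.Nonempty → GoodShells S → BarlowChart S := Iff.rfl

/-- **A bond**: a pair in the crux's window `(0, 28/25]`.  For a good `S` these are exactly the
twelve shell pairs of either endpoint (Disproof `margins` (1)–(2)). -/
def IsBond (x y : E3) : Prop := 0 < dist x y ∧ dist x y ≤ 28 / 25

/-- **Delone data of `S`** (conclusion of `stub_delone`): hard core `89/100`, covering radius
`3/4`, local finiteness (the hypotheses of the tree's
`biUnion_convexHull_delaunayCells_of_covering` / `finite_delaunayCells_sep_mem`). -/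
def IsDelone (S : Set E3) : Prop :=
  (∀ x ∈ S, ∀ y ∈ S, x ≠ y → (89 / 100 : ℝ) ≤ dist x y) ∧
  (∀ p : E3, ∃ x ∈ S, dist p x ≤ 3 / 4) ∧
  (∀ (p : E3) (R : ℝ), (S ∩ Metric.closedBall p R).Finite)

/-- **Truss cells** (conclusion of `stub_trussCells`): every canonical Delaunay cell of `S` (tree
`IsDelaunayCell`: ALL sites on an empty sphere, affinely spanning) is a bond tetrahedron, or is
inscribed in a bond octahedron `{x, x'} ∪ {y₁, y₂, y₃, y₄}` (induced `K₂,₂,₂`: twelve bonds, the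
three diagonals `xx'`, `y₁y₃`, `y₂y₄` longer than the window). -/
def HasTrussCells (S : Set E3) : Prop :=
  ∀ t : Set E3, IsDelaunayCell S t →
    (∃ x y z w : E3, t = ({x, y, z, w} : Set E3) ∧
      IsBond x y ∧ IsBond x z ∧ IsBond x w ∧ IsBond y z ∧ IsBond y w ∧ IsBond z w) ∨
    (∃ x x' y₁ y₂ y₃ y₄ : E3, ({x, x', y₁, y₂, y₃, y₄} : Set E3) ⊆ S ∧
      t ⊆ ({x, x', y₁, y₂, y₃, y₄} : Set E3) ∧
      IsBond x y₁ ∧ IsBond x y₂ ∧ IsBond x y₃ ∧ IsBond x y₄ ∧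
      IsBond x' y₁ ∧ IsBond x' y₂ ∧ IsBond x' y₃ ∧ IsBond x' y₄ ∧
      IsBond y₁ y₂ ∧ IsBond y₂ y₃ ∧ IsBond y₃ y₄ ∧ IsBond y₄ y₁ ∧
      28 / 25 < dist x x' ∧ 28 / 25 < dist y₁ y₃ ∧ 28 / 25 < dist y₂ y₄)

/-- **A star-exact development** (conclusion of `stub_radialDevelopment`, hypothesis of
`stub_radialLifting`): one map `D` which, recentred at each `D x`, carries the bonded neighbours of
`x` bijectively onto a rotated copy of the unit FCC or HCP pattern.  No global injectivity is
claimed.  (Bonded pairs then develop to distance `1` and, by the edge count `24 = 24`, each star map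
is a graph isomorphism `link(x) ≅ pattern`; triage r1-3 (F4).) -/
def IsStarExactDev (S : Set E3) (D : E3 → E3) : Prop :=
  ∀ x ∈ S, ∃ A : E3 →ₗᵢ[ℝ] E3,
    Set.BijOn (fun y : E3 => D y - D x) {y : E3 | y ∈ S ∧ 0 < dist x y ∧ dist x y ≤ 28 / 25}
        (A '' (fccKissingPattern : Set E3)) ∨
    Set.BijOn (fun y : E3 => D y - D x) {y : E3 | y ∈ S ∧ 0 < dist x y ∧ dist x y ≤ 28 / 25}
        (A '' (hcpKissingPattern : Set E3))

/-- **An exact development** (conclusion of `stub_radialLifting`, hypothesis of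
`stub_developedChart`): `1`-separated on `S` (hence injective), bond-faithful (bond ↔ developed
distance exactly `1`), with EXACT FCC/HCP distance-`1` shells inside `D '' S`. -/
def IsExactDev (S : Set E3) (D : E3 → E3) : Prop :=
  (∀ x ∈ S, ∀ y ∈ S, x ≠ y → (1 : ℝ) ≤ dist (D x) (D y)) ∧
  (∀ x ∈ S, ∀ y ∈ S, ((0 < dist x y ∧ dist x y ≤ 28 / 25) ↔ dist (D x) (D y) = 1)) ∧
  (∀ x ∈ S, ∃ A : E3 →ₗᵢ[ℝ] E3,
    {z : E3 | z ∈ D '' S ∧ dist z (D x) = 1} = (fun p : E3 => D x + A p) '' (fccKissingPattern : Set E3) ∨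
    {z : E3 | z ∈ D '' S ∧ dist z (D x) = 1} = (fun p : E3 => D x + A p) '' (hcpKissingPattern : Set E3))

/-! ## § 1  The five stubs (registered obligations; `sorry` lives only here) -/

/-- **stub A — `stub_delone` (size M; elementary, shared by every line on this crux).**
A non-empty every-point-good `S` is a Delone set with explicit constants: distinct points are
`≥ 89/100` apart, every point of space is within `3/4` of `S`, and `S` is locally finite.

Why plausibly true: (hard core) a point `y ≠ x` with `dist y x < 5aₓ/4` is a shell point
(`↑T =` the whole shell — `false_subshell` consumed here), matched within `aₓ/100` to a pattern
point of norm `aₓ` (`norm_eq_one_of_mem_fcc/hcpKissingPattern`), so `dist ≥ 0.99·aₓ ≥ 0.891`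
(`hardCore_bounds`, landed); otherwise `dist ≥ 5aₓ/4 ≥ 1.125`.  (covering) the twelve pattern
directions cover `S²` within `45°` (deep holes = square-face centres, both patterns; triage
capcheck/capsjob: `45.000°`), the actual shell directions within `45° + arcsin(0.01/0.99) = 45.58°`;
if `p` had nearest site `x` at distance `d > 1.01aₓ/(2 cos 45.58°) = 0.7215aₓ`, the shell point `y`
of `x` within `45.58°` of the direction of `p` would satisfy `dist p y < d` — contradiction; a
nearest site exists because `S ≠ ∅` is closed and locally finite (`false_without_nonempty`
consumed here).  (finiteness) hard core + compactness of closed balls.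
Why it might fail: only through a slip in the constants — margins `0.891 vs 0.89` and
`0.7215 vs 0.75`.
Leans on: `ShellCloseTo`, `EtaMatched`, `card_eq_twelve_of_shellCloseTo`,
`norm_eq_one_of_mem_fccKissingPattern`, `…hcp…`, landed `ShellsToBarlowChartNegative.hardCore_bounds`;
Mathlib `Metric.closedBall`, `IsCompact.finite`/`Set.Finite`, `exists_dist_lt_of_infDist_lt`,
`real_inner_le_norm`/spherical caps by inner products (the `45°` lemma is a finite check over the
`12`-point integer models `fccInt`, `hcpInt`: every unit vector has inner product `≥ cos 45° = 1/√2`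
with some pattern vector).  Sources: HalesDSP2012 §1.3; ConwaySloane1999 Ch. 4 §6.3 (covering
radius of fcc); Disproof.lean attack 1 ("`S` is Delone with covering radius `< 0.8`");
TRIAGE-r1-1 (0.7215 recomputed), CapcheckIdeator1.md. -/
theorem stub_delone :
    ∀ S : Set E3, S.Nonempty →
      (∀ x ∈ S, ∃ a : ℝ, 9 / 10 ≤ a ∧ a ≤ 1 ∧ ∃ T : Finset E3,
        (↑T : Set E3) = (fun y : E3 => y - x) '' {y : E3 | y ∈ S ∧ y ≠ x ∧ dist y x ≤ 5 / 4 * a} ∧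
        (ShellCloseTo (a / 100) T (Finset.image (fun v : E3 => a • v) fccKissingPattern) ∨
          ShellCloseTo (a / 100) T (Finset.image (fun v : E3 => a • v) hcpKissingPattern))) →
      (∀ x ∈ S, ∀ y ∈ S, x ≠ y → (89 / 100 : ℝ) ≤ dist x y) ∧
      (∀ p : E3, ∃ x ∈ S, dist p x ≤ 3 / 4) ∧
      (∀ (p : E3) (R : ℝ), (S ∩ Metric.closedBall p R).Finite) := by
  sorry

/-- **stub B — `stub_trussCells` (size L; THE tolerance-spending lemma of the line — "Delaunay
cells are truss cells").**  Every canonical Delaunay cell `t` of an every-point-good `S` (all sites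
on an empty sphere `sphere c r`, `ball c r ∩ S = ∅`, affinely spanning) is EITHER a bond
tetrahedron `{x, y, z, w}` (all six pairs in the window) OR is inscribed in a bond octahedron:
six sites `x, x', y₁, …, y₄ ∈ S` with the twelve octahedron edges bonds and the three diagonals
`> 28/25`, and `t ⊆ {x, x', y₁, y₂, y₃, y₄}` (generically `t` is one of the four Delaunay
tetrahedra `{x, x', yᵢ, yᵢ₊₁}` of a diagonal; `|t| = 5, 6` when the perturbed octahedron happens to
be cospherical — the exact case).

Why plausibly true: by `stub_delone` the empty sphere has `r ≤ 0.7215·a` and its centre lies in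
the star of its nearest site `x` (`B(x, 0.79a) ⊂ star(x)`); inside `star(x)` the two glued shells
(`x`'s and each neighbour's — use BOTH, triage r1-1/2/3, or the empty annulus `(5a/4, 1.33a)`:
nearest-direction neighbour `u` of a would-be intruder `p` at `dist p x < 1.33a` has
`dist p u < 0.99·a_u`, margin `0.02a` instead of `0.004a` at `27/20`) pin every site within `1.6a`
of `x` to `≤ 0.05a` of the ideal two-shell pattern (`fccTwoShellPattern`, TwoShellPatterns.lean),
where the empty spheres are the tetrahedral holes (circumradius `√(3/8)·a = 0.612a`, nearest
foreign site `1.02a` = hcp bipyramid apex, `1.17a` in fcc) and the octahedral holes (`a/√2 =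
0.707a`, nearest foreign site `√(3/2)·a = 1.225a`): margins `≥ 0.41a ≫ 0.05a`, so the sites on a
perturbed empty sphere are `4` vertices of one ideal cell (or `5`, `6` of one octahedron).
Bonds inside a cell are shell pairs (`≤ 1.01a ≤ 28/25`), diagonals are `≥ (√2 − 0.02)·0.9 = 1.2548
> 28/25` (`margins` (3)–(4), `false_without_scaleUpper/Lower` consumed here); a foreign vertex on
the sphere is the `false_subshell` witness shape, excluded by `↑T =` shell at the cell's vertices.
Toy (kit `j011074` = `toy/truss_check.py` v2, summary auto-attached to the item; v1 `j010938` had a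
slanted-boundary artefact and is superseded): Barlow patches fcc / hcp / dhcp / twin / random word,
`14³` sites, iid displacements of radius `δ ∈ {0, .003, .005, .007, .01}`, admissibility of every
interior site CHECKED (exhaustive frame seeds + Hungarian + Kabsch, scale `a ∈ [0.9, 1]`): 13
admissible cases (all `216` interior sites `≤ 1 %`), 25 cases up to `2.2 %` shell error; interior
Delaunay tetrahedra `≈ 18 500`: **0 violations** in every admissible case and 0 genuine ones
overall (the single flagged tetrahedron, hcp at `δ = 0.007`, inadmissible, is a two-diagonal
SLIVER `{x, x', y₁, y₃} ⊆ O` — inside this stub's second disjunct; the toy's classifier was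
stricter than the stub); covering radius `≤ 0.7104` (theory `0.7215`, stub A claims `3/4`); min
pair distance `0.9815`; emptiness margin (nearest foreign site − sphere radius) `≥ 0.394a` (exact
hcp bipyramid `1.0206 − 0.6124 = 0.408a`); max bond inside cells `1.018 ≤ 28/25`; in-cell
diagonals `∈ [1.396, 1.421] > 1.2548`; annulus `(5a/4, 1.33a)` empty at every site (nearest
beyond-shell distance `1.396`).  Decision rule for re-runs: any VIOLATION in an admissible case
kills this stub as cut, and with it the Delaunay front end of the line.  ENGINEERING NOTE for
C1/C2 provers (from the sliver): never extend `D` affinely on the Delaunay SUB-cells of an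
octahedron — use the Delaunay cells only to identify the octahedra, then triangulate each
octahedron by one chosen diagonal into four fat tetrahedra.
Why it might fail: a Delaunay tetrahedron of a `1 %`-good set using a `√2`-diagonal together with a
vertex outside that octahedron (needs an empty sphere of radius `≈ 0.9a` — excluded by covering
radius `0.7215a`, unless the two-shell pinning to `0.05a` is wrong somewhere, e.g. at an hcp
bipyramid where the foreign-site margin is smallest, `1.02a − 0.612a`).
Leans on: `IsDelaunayCell`, `IsDelaunayCell.exists_sphere_radius_le`, `.subset_closedBall`,
`.inter_convexHull_eq`, `delaunayCells` (DelaunaySubdivision.lean); `fccTwoShellPattern` /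
`hcp…` (TwoShellPatterns.lean), `kissingShell_add_eq_layerShell_of_hcp`,
`hexagon_subset_kissingShell_add_of_fcc` (LayerPropagation.lean) as the exact-case templates;
landed `ShellsToBarlowChartNegative.margins`-type facts (`hardCore_bounds`, `capClash_lt_hardCore`,
`equatorPropagation_margin`); Mathlib `EuclideanGeometry` (circumsphere of `4` points:
`Affine.Simplex.circumsphere`), `inner_sub_sub_self`-style power computations
(`DelaunaySubdivision.sum_mul_dist_sq`).  Sources: ConwaySloane1999 Ch. 2 §1.2 (Delaunay cells of
fcc = tetrahedra + octahedra); BoissonnatYvinec1998 §17.3; HalesDSP2012 §1.3; Disproof.lean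
`false_subshell` + § Local rigidity; TRIAGE-r1-2 (margins `0.612/1.02`, `0.707/1.225` by hand). -/
theorem stub_trussCells :
    ∀ S : Set E3,
      (∀ x ∈ S, ∃ a : ℝ, 9 / 10 ≤ a ∧ a ≤ 1 ∧ ∃ T : Finset E3,
        (↑T : Set E3) = (fun y : E3 => y - x) '' {y : E3 | y ∈ S ∧ y ≠ x ∧ dist y x ≤ 5 / 4 * a} ∧
        (ShellCloseTo (a / 100) T (Finset.image (fun v : E3 => a • v) fccKissingPattern) ∨
          ShellCloseTo (a / 100) T (Finset.image (fun v : E3 => a • v) hcpKissingPattern))) →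
      ∀ t : Set E3, IsDelaunayCell S t →
        (∃ x y z w : E3, t = ({x, y, z, w} : Set E3) ∧
          (0 < dist x y ∧ dist x y ≤ 28 / 25) ∧ (0 < dist x z ∧ dist x z ≤ 28 / 25) ∧
          (0 < dist x w ∧ dist x w ≤ 28 / 25) ∧ (0 < dist y z ∧ dist y z ≤ 28 / 25) ∧
          (0 < dist y w ∧ dist y w ≤ 28 / 25) ∧ (0 < dist z w ∧ dist z w ≤ 28 / 25)) ∨
        (∃ x x' y₁ y₂ y₃ y₄ : E3, ({x, x', y₁, y₂, y₃, y₄} : Set E3) ⊆ S ∧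
          t ⊆ ({x, x', y₁, y₂, y₃, y₄} : Set E3) ∧
          (0 < dist x y₁ ∧ dist x y₁ ≤ 28 / 25) ∧ (0 < dist x y₂ ∧ dist x y₂ ≤ 28 / 25) ∧
          (0 < dist x y₃ ∧ dist x y₃ ≤ 28 / 25) ∧ (0 < dist x y₄ ∧ dist x y₄ ≤ 28 / 25) ∧
          (0 < dist x' y₁ ∧ dist x' y₁ ≤ 28 / 25) ∧ (0 < dist x' y₂ ∧ dist x' y₂ ≤ 28 / 25) ∧
          (0 < dist x' y₃ ∧ dist x' y₃ ≤ 28 / 25) ∧ (0 < dist x' y₄ ∧ dist x' y₄ ≤ 28 / 25) ∧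
          (0 < dist y₁ y₂ ∧ dist y₁ y₂ ≤ 28 / 25) ∧ (0 < dist y₂ y₃ ∧ dist y₂ y₃ ≤ 28 / 25) ∧
          (0 < dist y₃ y₄ ∧ dist y₃ y₄ ≤ 28 / 25) ∧ (0 < dist y₄ y₁ ∧ dist y₄ y₁ ≤ 28 / 25) ∧
          28 / 25 < dist x x' ∧ 28 / 25 < dist y₁ y₃ ∧ 28 / 25 < dist y₂ y₄) := by
  sorry

/-- **stub C1 — `stub_radialDevelopment` (size XL; THE LEVER — the hardest stub).**  A non-empty
every-point-good `S` that is Delone (conclusion of `stub_delone`) and has truss Delaunay cells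
(conclusion of `stub_trussCells`) admits a STAR-EXACT DEVELOPMENT: one map `D : ℝ³ → ℝ³` such that
for every `x ∈ S`, `y ↦ D y − D x` is a bijection from the bonded neighbours of `x` onto `A_x(P)`,
`A_x` a linear isometry, `P` the unit FCC or HCP pattern.

Why plausibly true (the card's mechanism): the Delaunay polytopes tile `ℝ³` face to face with
disjoint interiors (`biUnion_convexHull_delaunayCells_of_covering`, `convexHull_inter_convexHull`,
`disjoint_interior_convexHull` — hypotheses = the Delone block); by the truss block each cell is a
`≤ 5 %`-distorted regular tetrahedron / (part of an) octahedron of edge `≈ a` (work with the bond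
tetrahedra and the WHOLE octahedra, each cut by one chosen diagonal when a piecewise-affine chart
is needed — Delaunay sub-cells of an octahedron may be slivers, toy j011074); the window graph has
exactly the cuboctahedron / anticuboctahedron links (Disproof `margins`: no combinatorial slack), so
around every bond sit exactly `2` tetrahedra `+ 2` octahedra; DECLARE every cell regular of edge
`1`: the cellwise-Euclidean length structure on `ℝ³` is flat across open faces, around every edge
(`2·arccos(1/3) + 2·arccos(−1/3) = 2π` in either cyclic order) and hence at every vertex (the link
of a vertex is a compact spherical surface without cone points, i.e. the round `S²`; equivalently
`ℝ³ ∖ S` is simply connected, codimension `3`).  DEVELOP: either (card) radially from a base atom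
`v₀` — continue the star chart of `v₀` along the straight segments `[v₀, p]` of actual `ℝ³`
(star-shaped: no homotopies; continuity of `Dev` = trivial holonomy of thin FILLED triangles, by a
Lebesgue-number argument along the compact segment — triage r1-3's sharpening, honestly a small
homotopy), or (merge with `straightening-development`, triage ×3) build the `GStructure.Atlas` of
developed open vertex stars on `M = ℝ³` (charts open at points, transitions single rigid motions by
face-chaining, `SimplyConnectedSpace (EuclideanSpace ℝ (Fin 3))` by
`SimplyConnectedSpace.ofContractible`) and call `GStructure.Atlas.exists_developingMap'`
(GStructureDevelopment.lean:413, PROVED); local developing maps agreeing near a point agree on the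
connected star, so `Dev` restricted to each closed star is the isometry of the flat star onto the
exact pattern star: `D := Dev|_S` is star-exact, with `A_x` proper or improper as `ShellCloseTo`
allows.  `S.Nonempty` = the base atom (`false_without_nonempty`); the window enters only through
"bonded neighbours = shell" (`false_without_scale*`).
Why it might fail: not in truth (ideal stackings develop by a similarity; the flatness identities
are exact) but in COST — a flat atlas on a concrete perturbed tiling (charts = piecewise-affine
straightenings of `14`-cell vertex stars, openness at points, rigid transitions) is `≈ 1–2 k` lines
over Mathlib's affine/convex API; the bet (card + triage) is that no algebraic topology beyond
`SimplyConnectedSpace ℝ³` / star-shapedness is needed.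
Leans on: `IsDelaunayCell.convexHull_inter_convexHull`, `.isExposed_inter`, `.inter_convexHull_eq`,
`disjoint_interior_convexHull`, `biUnion_convexHull_delaunayCells_of_covering`,
`finite_delaunayCells_sep_mem` (DelaunaySubdivision.lean); `GStructure.Atlas`,
`GStructure.Atlas.exists_developingMap'` (Literature/Geometry/Manifold/GStructureDevelopment.lean);
`card_eq_twelve_of_shellCloseTo`, `one_le_dist_of_mem_fcc/hcpKissingPattern` (KissingPatterns);
`fccTab`/`hcpTab` link tables (KissingRigidity); Mathlib `AffineMap`, `AffineIndependent`,
`interior_convexHull_nonempty_iff_affineSpan_eq_top`, `lebesgue_number_lemma_of_metric`,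
`Real.arccos`, `SimplyConnectedSpace.ofContractible`, `Convex.contractibleSpace`.
Sources: BenedettiPetronio1992 §B.1 (Prop. B.1.3, Thm B.1.5: complete simply connected flat
`(X,G)`-manifold develops bijectively); Thurston, *Three-Dimensional Geometry and Topology* §3.4
(developing map, holonomy); ConwayJiaoTorquato2011 (doi:10.1073/pnas.1105594108: why the
FACE-TO-FACE truss with its links, not merely "a tiling by regular cells", must be developed);
FlatleyTheil2015 (arXiv:1407.0692) Props 3.12–3.14 (nearest printed local fcc charts, no global
step); card flat-radial-development; TRIAGE-r1-1 (closer sound), r1-2 (merge), r1-3 (thin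
triangles). -/
theorem stub_radialDevelopment :
    ∀ S : Set E3, S.Nonempty →
      (∀ x ∈ S, ∃ a : ℝ, 9 / 10 ≤ a ∧ a ≤ 1 ∧ ∃ T : Finset E3,
        (↑T : Set E3) = (fun y : E3 => y - x) '' {y : E3 | y ∈ S ∧ y ≠ x ∧ dist y x ≤ 5 / 4 * a} ∧
        (ShellCloseTo (a / 100) T (Finset.image (fun v : E3 => a • v) fccKissingPattern) ∨
          ShellCloseTo (a / 100) T (Finset.image (fun v : E3 => a • v) hcpKissingPattern))) →
      ((∀ x ∈ S, ∀ y ∈ S, x ≠ y → (89 / 100 : ℝ) ≤ dist x y) ∧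
        (∀ p : E3, ∃ x ∈ S, dist p x ≤ 3 / 4) ∧
        (∀ (p : E3) (R : ℝ), (S ∩ Metric.closedBall p R).Finite)) →
      (∀ t : Set E3, IsDelaunayCell S t →
        (∃ x y z w : E3, t = ({x, y, z, w} : Set E3) ∧
          (0 < dist x y ∧ dist x y ≤ 28 / 25) ∧ (0 < dist x z ∧ dist x z ≤ 28 / 25) ∧
          (0 < dist x w ∧ dist x w ≤ 28 / 25) ∧ (0 < dist y z ∧ dist y z ≤ 28 / 25) ∧
          (0 < dist y w ∧ dist y w ≤ 28 / 25) ∧ (0 < dist z w ∧ dist z w ≤ 28 / 25)) ∨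
        (∃ x x' y₁ y₂ y₃ y₄ : E3, ({x, x', y₁, y₂, y₃, y₄} : Set E3) ⊆ S ∧
          t ⊆ ({x, x', y₁, y₂, y₃, y₄} : Set E3) ∧
          (0 < dist x y₁ ∧ dist x y₁ ≤ 28 / 25) ∧ (0 < dist x y₂ ∧ dist x y₂ ≤ 28 / 25) ∧
          (0 < dist x y₃ ∧ dist x y₃ ≤ 28 / 25) ∧ (0 < dist x y₄ ∧ dist x y₄ ≤ 28 / 25) ∧
          (0 < dist x' y₁ ∧ dist x' y₁ ≤ 28 / 25) ∧ (0 < dist x' y₂ ∧ dist x' y₂ ≤ 28 / 25) ∧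
          (0 < dist x' y₃ ∧ dist x' y₃ ≤ 28 / 25) ∧ (0 < dist x' y₄ ∧ dist x' y₄ ≤ 28 / 25) ∧
          (0 < dist y₁ y₂ ∧ dist y₁ y₂ ≤ 28 / 25) ∧ (0 < dist y₂ y₃ ∧ dist y₂ y₃ ≤ 28 / 25) ∧
          (0 < dist y₃ y₄ ∧ dist y₃ y₄ ≤ 28 / 25) ∧ (0 < dist y₄ y₁ ∧ dist y₄ y₁ ≤ 28 / 25) ∧
          28 / 25 < dist x x' ∧ 28 / 25 < dist y₁ y₃ ∧ 28 / 25 < dist y₂ y₄)) →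
      ∃ D : E3 → E3, ∀ x ∈ S, ∃ A : E3 →ₗᵢ[ℝ] E3,
        Set.BijOn (fun y : E3 => D y - D x) {y : E3 | y ∈ S ∧ 0 < dist x y ∧ dist x y ≤ 28 / 25}
            (A '' (fccKissingPattern : Set E3)) ∨
        Set.BijOn (fun y : E3 => D y - D x) {y : E3 | y ∈ S ∧ 0 < dist x y ∧ dist x y ≤ 28 / 25}
            (A '' (hcpKissingPattern : Set E3)) := by
  sorry

/-- **stub C2 — `stub_radialLifting` (size L; the global "no boundary ⇒ no overlap" step; shared
verbatim in substance with card `distance-sweep-development`'s `RadialLifting`).**  For an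
every-point-good `S` with the Delone and truss data, EVERY star-exact development `D` is an exact
development: `1`-separated on `S` (so injective), bond-faithful (`bond ↔ dist (D x) (D y) = 1`), with
exact FCC/HCP distance-`1` shells in `D '' S`.

Why plausibly true (card: "LIFT RADIALLY BACK"; triage r1-1/2/3: sound): extend `D` cellwise
affinely over the truss cells — bond tetrahedra as they are, each bond octahedron triangulated by
ONE CHOSEN diagonal into four fat tetrahedra (not by its Delaunay sub-cells, which may be
two-diagonal slivers `{x, x', y₁, y₃}`: toy j011074); all pieces are non-degenerate since edges lie
in `[0.89, 1.12]` and diagonals in `[1.39, 1.43]`.  Star-exactness makes each star map a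
graph isomorphism `link(x) ≅ pattern` (the `24` bonded pairs among the twelve neighbours develop
to distance `1`, and `A_x(P)` has exactly `24` unit pairs), so bond tetrahedra develop to regular
unit tetrahedra and octahedra to regular unit octahedra (diagonals = opposite vertices of an
induced `4`-cycle of a link ↦ `√2`), and NO FOLD can occur: across a `T|T` or `O|O` face
(hcp-type) a fold would identify the images of two neighbours of a common vertex, across a `T|O`
face the folded apex sits at the centroid of the far octahedron face, `1/√3 < 1` from the image of
another neighbour — all contradict injectivity of the star bijection; around an edge the four
images wind once (`2·70.53° + 2·109.47° = 360°`), at a vertex the link map `S² → S²` is a covering,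
hence a homeomorphism.  So the extension `D̂ : ℝ³ → E³` is a local homeomorphism, uniformly (cell
sizes and bi-Lipschitz constants bounded), hence — `ℝ³` with the (complete) cellwise-flat length
metric, every point having a full star: THIS is where "EVERY point" acts globally — a covering map
onto `E³` (the `15`-line uniform covering criterion of card straightening, checked TRUE by all three
triagers; or the card's radial lifting `Λ` of model segments from `D v₀`: a continuous injective
local section with clopen image), hence a bijection (`E³` simply connected: Mathlib
`IsCoveringMap` monodromy / tree `injective_of_star`, `IsCoveringMap.surjective_of_connectedSpace`).
Consequences: `D` is injective on `S`; the image cells tile `E³` face to face by unit regular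
tetrahedra/octahedra with vertex set `D '' S`; the closed star of an image vertex contains
`B(D x, √(2/3))`, stars of non-co-cellular vertices have disjoint interiors, so non-co-cellular
image pairs are `≥ 1.633` apart and co-cellular ones at `1` or `√2`: `1`-separation and
bond-faithfulness; the distance-`1` set around `D x` is then exactly the image star `D x + A_x(P)`.
The far field of a screw dislocation (locally perfect truss, NOT Barlow) shows the stub is sharp:
there the lifting gets stuck at the missing core — excluded here because every point has a full
shell (card, falsifier (c)).
Why it might fail: a star-exact development whose cellwise extension folds along a surface meeting
no vertex star injectively-detectably — ruled out above face type by face type, but the `O|O` and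
`T|T` cases use that the two far vertices share a neighbour, which must be re-checked in the
sub-triangulated (cospherical) octahedron; Lean cost of `IsCoveringMap` for a piecewise-affine map.
Leans on: `IsDelaunayCell.*`, `biUnion_convexHull_delaunayCells_of_covering`,
`disjoint_interior_convexHull` (DelaunaySubdivision); `isArrangedIn_fcc_of_contactGraph_iso` /
`…hcp…` (KissingRigidity.lean:1511/1520, PROVED Hales Lemma 10) if the shell clause is derived from
contact graphs instead of from star-exactness; Mathlib `IsLocalHomeomorph`, `IsCoveringMap`,
`IsCoveringMap.existsUnique_continuousMap_lifts` / `liftPath`, `SimplyConnectedSpace`; tree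
`Literature.Geometry.Riemannian.injective_of_star` (StarLiftInjective.lean:135),
`IsCoveringMap.surjective_of_connectedSpace` (AFEndCovering.lean:811).
Sources: BenedettiPetronio1992 Thm B.1.5; KlemanFriedel2008 (doi:10.1103/RevModPhys.80.61,
Volterra process: why completeness is load-bearing); card flat-radial-development (Λ); card
straightening-development (`isCoveringMap_of_uniform`); TRIAGE-r1-1/2/3. -/
theorem stub_radialLifting :
    ∀ S : Set E3,
      (∀ x ∈ S, ∃ a : ℝ, 9 / 10 ≤ a ∧ a ≤ 1 ∧ ∃ T : Finset E3,
        (↑T : Set E3) = (fun y : E3 => y - x) '' {y : E3 | y ∈ S ∧ y ≠ x ∧ dist y x ≤ 5 / 4 * a} ∧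
        (ShellCloseTo (a / 100) T (Finset.image (fun v : E3 => a • v) fccKissingPattern) ∨
          ShellCloseTo (a / 100) T (Finset.image (fun v : E3 => a • v) hcpKissingPattern))) →
      ((∀ x ∈ S, ∀ y ∈ S, x ≠ y → (89 / 100 : ℝ) ≤ dist x y) ∧
        (∀ p : E3, ∃ x ∈ S, dist p x ≤ 3 / 4) ∧
        (∀ (p : E3) (R : ℝ), (S ∩ Metric.closedBall p R).Finite)) →
      (∀ t : Set E3, IsDelaunayCell S t →
        (∃ x y z w : E3, t = ({x, y, z, w} : Set E3) ∧
          (0 < dist x y ∧ dist x y ≤ 28 / 25) ∧ (0 < dist x z ∧ dist x z ≤ 28 / 25) ∧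
          (0 < dist x w ∧ dist x w ≤ 28 / 25) ∧ (0 < dist y z ∧ dist y z ≤ 28 / 25) ∧
          (0 < dist y w ∧ dist y w ≤ 28 / 25) ∧ (0 < dist z w ∧ dist z w ≤ 28 / 25)) ∨
        (∃ x x' y₁ y₂ y₃ y₄ : E3, ({x, x', y₁, y₂, y₃, y₄} : Set E3) ⊆ S ∧
          t ⊆ ({x, x', y₁, y₂, y₃, y₄} : Set E3) ∧
          (0 < dist x y₁ ∧ dist x y₁ ≤ 28 / 25) ∧ (0 < dist x y₂ ∧ dist x y₂ ≤ 28 / 25) ∧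
          (0 < dist x y₃ ∧ dist x y₃ ≤ 28 / 25) ∧ (0 < dist x y₄ ∧ dist x y₄ ≤ 28 / 25) ∧
          (0 < dist x' y₁ ∧ dist x' y₁ ≤ 28 / 25) ∧ (0 < dist x' y₂ ∧ dist x' y₂ ≤ 28 / 25) ∧
          (0 < dist x' y₃ ∧ dist x' y₃ ≤ 28 / 25) ∧ (0 < dist x' y₄ ∧ dist x' y₄ ≤ 28 / 25) ∧
          (0 < dist y₁ y₂ ∧ dist y₁ y₂ ≤ 28 / 25) ∧ (0 < dist y₂ y₃ ∧ dist y₂ y₃ ≤ 28 / 25) ∧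
          (0 < dist y₃ y₄ ∧ dist y₃ y₄ ≤ 28 / 25) ∧ (0 < dist y₄ y₁ ∧ dist y₄ y₁ ≤ 28 / 25) ∧
          28 / 25 < dist x x' ∧ 28 / 25 < dist y₁ y₃ ∧ 28 / 25 < dist y₂ y₄)) →
      ∀ D : E3 → E3,
        (∀ x ∈ S, ∃ A : E3 →ₗᵢ[ℝ] E3,
          Set.BijOn (fun y : E3 => D y - D x) {y : E3 | y ∈ S ∧ 0 < dist x y ∧ dist x y ≤ 28 / 25}
              (A '' (fccKissingPattern : Set E3)) ∨
          Set.BijOn (fun y : E3 => D y - D x) {y : E3 | y ∈ S ∧ 0 < dist x y ∧ dist x y ≤ 28 / 25}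
              (A '' (hcpKissingPattern : Set E3))) →
        (∀ x ∈ S, ∀ y ∈ S, x ≠ y → (1 : ℝ) ≤ dist (D x) (D y)) ∧
        (∀ x ∈ S, ∀ y ∈ S, ((0 < dist x y ∧ dist x y ≤ 28 / 25) ↔ dist (D x) (D y) = 1)) ∧
        (∀ x ∈ S, ∃ A : E3 →ₗᵢ[ℝ] E3,
          {z : E3 | z ∈ D '' S ∧ dist z (D x) = 1} =
              (fun p : E3 => D x + A p) '' (fccKissingPattern : Set E3) ∨
          {z : E3 | z ∈ D '' S ∧ dist z (D x) = 1} =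
              (fun p : E3 => D x + A p) '' (hcpKissingPattern : Set E3)) := by
  sorry

/-- **stub T — `stub_developedChart` (size M; the Transfer `C⁺ → crux`, provable NOW; no `GoodShells`
needed).**  A non-empty `S` with an exact development `D` (injective and `1`-separated on `S`,
bond-faithful, exact FCC/HCP distance-`1` shells) satisfies the crux conclusion `BarlowChart S`.

Proof plan (checked against the tree types by triage r1-1/2): `V := (fun z => (2 : ℝ) • z) '' (D '' S)`
is an `IsUnitBallPacking` (`dist < 2 ⇒` equal, from `1`-separation), `V.Nonempty` from
`S.Nonempty` (`false_without_nonempty` consumed here), and `HasFccOrHcpShells V`: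
`kissingShell V (2 • D x) = (fun p => (2 : ℝ) • A p) '' ↑P` is literally `IsArrangedIn` (shell
clause + `kissingShell_eq_image`); `HalesDSP_layerPackings_holds` (LayerStackings.lean:412, PROVED)
gives a Hägg `s` and `g : E3 ≃ᵢ E3` with `V = g '' barlowStacking 2 (2 * √(2/3)) s`; rescale with the
LANDED `ShellsToBarlowChartNegative.smul_mem_barlowStacking_iff` / `smul_barlowPos`
(`2 • p ∈ barlowStacking 2 (2√(2/3)) s ↔ p ∈ barlowStacking 1 √(2/3) s`); put
`Φ p := the x ∈ S with 2 • D x = g (2 • p)` (`Function.invFunOn`); `BijOn` from injectivity of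
`D` on `S`; `dist p q = 1 ↔ dist (g (2p)) (g (2q)) = 2 ↔ dist (D (Φ p)) (D (Φ q)) = 1 ↔ bond`
(bond-faithfulness).  The word `s` is whatever Hales returns (`not_shellsToFccChart` respected).
Why it might fail: it cannot mathematically (Hales's exact theorem is in the tree with exactly this
shape); only bookkeeping risk (`Set.BijOn`/`invFunOn`, the factor `2`).
Leans on: `HalesDSP_layerPackings_holds`, `HalesDSP_layerPackings`, `IsUnitBallPacking`,
`kissingShell`, `kissingShell_eq_image`, `IsArrangedIn`, `HasFccOrHcpShells`
(FejesTothKissingTwelve / LayerStackings); landed `ShellsToBarlowChartNegative.smul_barlowPos`,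
`.smul_mem_barlowStacking_iff`, `.half_smul_mem_iff` (Negative/Calibration.lean); Mathlib
`Set.BijOn`, `Set.InjOn.bijOn_image`, `Function.invFunOn`, `IsometryEquiv.dist_eq`, `dist_smul₀`.
Sources: HalesDSP2012 §1.3 pp. 12–13; Hales2012 (arXiv:1209.6043) Thm 1 / Lemma 10; SketchIdeator1
`DevelopedChart`; TRIAGE-r1-1/2 (end-game types checked). -/
theorem stub_developedChart :
    ∀ S : Set E3, S.Nonempty → ∀ D : E3 → E3,
      ((∀ x ∈ S, ∀ y ∈ S, x ≠ y → (1 : ℝ) ≤ dist (D x) (D y)) ∧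
        (∀ x ∈ S, ∀ y ∈ S, ((0 < dist x y ∧ dist x y ≤ 28 / 25) ↔ dist (D x) (D y) = 1)) ∧
        (∀ x ∈ S, ∃ A : E3 →ₗᵢ[ℝ] E3,
          {z : E3 | z ∈ D '' S ∧ dist z (D x) = 1} =
              (fun p : E3 => D x + A p) '' (fccKissingPattern : Set E3) ∨
          {z : E3 | z ∈ D '' S ∧ dist z (D x) = 1} =
              (fun p : E3 => D x + A p) '' (hcpKissingPattern : Set E3))) →
      ∃ s : ℤ → ℤ, IsHaggSeq s ∧ ∃ Φ : E3 → E3,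
        Set.BijOn Φ (barlowStacking 1 (Real.sqrt (2 / 3)) s) S ∧
        ∀ p ∈ barlowStacking 1 (Real.sqrt (2 / 3)) s, ∀ q ∈ barlowStacking 1 (Real.sqrt (2 / 3)) s,
          (dist p q = 1 ↔ (0 < dist (Φ p) (Φ q) ∧ dist (Φ p) (Φ q) ≤ 28 / 25)) := by
  sorry

/-! ## § 2  Read-backs: the inlined blocks ARE the § 0 vocabulary (definitional) -/

/-- `stub_delone` reads `∀ S, S.Nonempty → GoodShells S → IsDelone S`. -/
theorem delone_iff : (∀ S : Set E3, S.Nonempty → GoodShells S → IsDelone S) ↔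
    (∀ S : Set E3, S.Nonempty →
      (∀ x ∈ S, ∃ a : ℝ, 9 / 10 ≤ a ∧ a ≤ 1 ∧ ∃ T : Finset E3,
        (↑T : Set E3) = (fun y : E3 => y - x) '' {y : E3 | y ∈ S ∧ y ≠ x ∧ dist y x ≤ 5 / 4 * a} ∧
        (ShellCloseTo (a / 100) T (Finset.image (fun v : E3 => a • v) fccKissingPattern) ∨
          ShellCloseTo (a / 100) T (Finset.image (fun v : E3 => a • v) hcpKissingPattern))) →
      (∀ x ∈ S, ∀ y ∈ S, x ≠ y → (89 / 100 : ℝ) ≤ dist x y) ∧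
      (∀ p : E3, ∃ x ∈ S, dist p x ≤ 3 / 4) ∧
      (∀ (p : E3) (R : ℝ), (S ∩ Metric.closedBall p R).Finite)) := Iff.rfl

/-- `stub_trussCells` reads `∀ S, GoodShells S → HasTrussCells S`. -/
theorem trussCells_iff (S : Set E3) : HasTrussCells S ↔
    (∀ t : Set E3, IsDelaunayCell S t →
        (∃ x y z w : E3, t = ({x, y, z, w} : Set E3) ∧
          (0 < dist x y ∧ dist x y ≤ 28 / 25) ∧ (0 < dist x z ∧ dist x z ≤ 28 / 25) ∧
          (0 < dist x w ∧ dist x w ≤ 28 / 25) ∧ (0 < dist y z ∧ dist y z ≤ 28 / 25) ∧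
          (0 < dist y w ∧ dist y w ≤ 28 / 25) ∧ (0 < dist z w ∧ dist z w ≤ 28 / 25)) ∨
        (∃ x x' y₁ y₂ y₃ y₄ : E3, ({x, x', y₁, y₂, y₃, y₄} : Set E3) ⊆ S ∧
          t ⊆ ({x, x', y₁, y₂, y₃, y₄} : Set E3) ∧
          (0 < dist x y₁ ∧ dist x y₁ ≤ 28 / 25) ∧ (0 < dist x y₂ ∧ dist x y₂ ≤ 28 / 25) ∧
          (0 < dist x y₃ ∧ dist x y₃ ≤ 28 / 25) ∧ (0 < dist x y₄ ∧ dist x y₄ ≤ 28 / 25) ∧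
          (0 < dist x' y₁ ∧ dist x' y₁ ≤ 28 / 25) ∧ (0 < dist x' y₂ ∧ dist x' y₂ ≤ 28 / 25) ∧
          (0 < dist x' y₃ ∧ dist x' y₃ ≤ 28 / 25) ∧ (0 < dist x' y₄ ∧ dist x' y₄ ≤ 28 / 25) ∧
          (0 < dist y₁ y₂ ∧ dist y₁ y₂ ≤ 28 / 25) ∧ (0 < dist y₂ y₃ ∧ dist y₂ y₃ ≤ 28 / 25) ∧
          (0 < dist y₃ y₄ ∧ dist y₃ y₄ ≤ 28 / 25) ∧ (0 < dist y₄ y₁ ∧ dist y₄ y₁ ≤ 28 / 25) ∧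
          28 / 25 < dist x x' ∧ 28 / 25 < dist y₁ y₃ ∧ 28 / 25 < dist y₂ y₄)) := Iff.rfl

/-- The four structural stubs in vocabulary form (what the composition below does, read without
the inlined blocks): Delone + truss cells + radial development + radial lifting give an exact
development, and the developed chart closes. -/
theorem barlowChart_of_parts {S : Set E3} (hne : S.Nonempty) (hgood : GoodShells S)
    (hA : S.Nonempty → GoodShells S → IsDelone S) (hB : GoodShells S → HasTrussCells S)
    (hC₁ : S.Nonempty → GoodShells S → IsDelone S → HasTrussCells S → ∃ D, IsStarExactDev S D)
    (hC₂ : GoodShells S → IsDelone S → HasTrussCells S → ∀ D, IsStarExactDev S D → IsExactDev S D)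
    (hT : S.Nonempty → ∀ D, IsExactDev S D → BarlowChart S) : BarlowChart S := by
  obtain ⟨D, hD⟩ := hC₁ hne hgood (hA hne hgood) (hB hgood)
  exact hT hne D (hC₂ hgood (hA hne hgood) (hB hgood) D hD)

/-! ## § 3  The composition — concludes the crux BY NAME, no hypotheses, sorries only in the stubs -/

/-- **`ShellsToBarlowChart` from the five stubs.**  Given `S ≠ ∅` with good shells everywhere:
`stub_delone` and `stub_trussCells` supply the Delone constants and the truss cells;
`stub_radialDevelopment` develops; `stub_radialLifting` upgrades the star-exact development to an
exact one; `stub_developedChart` reads the Hägg word and the chart off Hales's layer theorem. -/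
theorem ShellsToBarlowChart_of : ShellsToBarlowChart := by
  intro S hne hgood
  have hA := stub_delone S hne hgood
  have hB := stub_trussCells S hgood
  obtain ⟨D, hD⟩ := stub_radialDevelopment S hne hgood hA hB
  exact stub_developedChart S hne D (stub_radialLifting S hgood hA hB D hD)

end Summit.AtomisticToContinuum.Crystallization.Cruxes.ShellsToBarlowChart.FlatRadialDevelopment

end
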